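import Mathlib
import Summits.PneNP.PneNP.Theorems.OverlapGapAlgebraSolvableImpliesStableSectionMonotoneRepairDynamics
import Summits.PneNP.PneNP.Theorems.OverlapGapAlgebraSolvableImpliesStableSectionMonotoneRepairWalkExtract
import Summits.PneNP.PneNP.Theorems.OverlapGapAlgebraSolvableImpliesStableSectionMonotoneRepairTreeWalks
import Summits.PneNP.PneNP.Theorems.OverlapGapAlgebraSolvableImpliesStableSectionMonotoneRepairWalkOps

/-!
# PneNP / OverlapGapAlgebra — crux `SolvableImpliesStableSection` (stmt-PneNP-2463):
# the MONOTONE REPAIR block (14/·) — a non-injective witness tree yields a bad walk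

Support for crux `stmt-PneNP-2463` (`Summit.PneNP.PneNP.Theses.OverlapGapAlgebra.SolvableImpliesStableSection`):
the f-free block "bounded-round monotone repair gives stable sections up to `α ≤ 2^k/(4k)`".
If two nodes of a syntactically valid tree code carry the same clause, then — inducting on the sum of
their depths — either one is the root (walk up from the other: a closed clause-walk from the root
clause), or they are siblings (walk down to the parent, close with the two sibling slots), or their
parents carry the same clause (induction), or the walk down to one parent, across to the other parent
(both carry the child's least-negative-slot variable) and up to the root is a closed clause-walk.  In
every case the root clause starts a bad walk (`…WalkExtract`, `…TreeWalks`, `…WalkOps`):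

* `sissR_badWalk_of_rootRepeat` — a non-root node carrying the root clause gives a bad walk;
* `sissR_injOrBad` — a well-formed, syntactically valid tree code of depth `≤ D` whose nodes do
  NOT carry pairwise distinct clauses gives a bad walk of length `≤ 2D` from its root clause.
No definitions; axioms `propext`, `Classical.choice`, `Quot.sound`.
-/

set_option linter.dupNamespace false -- `Summit.PneNP.PneNP.…`: summit = sub-problem (D-0017)

namespace Summit.PneNP.PneNP.Theorems

open Finset
open scoped Classical

section InjOrBad

variable {m k n : ℕ}

/-- **A non-root node carrying the root clause gives a bad walk** (walk up to the root: a closed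
clause-walk of length `|b| ≥ 1`). -/
theorem sissR_badWalk_of_rootRepeat (T : Finset (List (Fin k) × (Fin m × ℕ))) (Φ : (Fin m → Fin k → Fin n × Bool))
    (hfun : ∀ (a : List (Fin k)) (lab lab' : Fin m × ℕ), (a, lab) ∈ T → (a, lab') ∈ T → lab = lab')
    (hpar : ∀ (j : Fin k) (a : List (Fin k)) (lab : Fin m × ℕ), (j :: a, lab) ∈ T →
      ∃ lab' : Fin m × ℕ, (a, lab') ∈ T)
    (hsyn : ∀ e ∈ T, ∀ j : Fin k,
      (((Φ e.2.1 j).2 = true ↔ ∃ lab : Fin m × ℕ, (j :: e.1, lab) ∈ T) ∧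
      ∀ (y : Fin m) (s : ℕ), (j :: e.1, (y, s)) ∈ T → ∃ j' : Fin k,
        (∀ lab : Fin m × ℕ, (j' :: j :: e.1, lab) ∉ T) ∧
        (∀ j'' : Fin k, j'' < j' → ∃ lab : Fin m × ℕ, (j'' :: j :: e.1, lab) ∈ T) ∧
        (Φ e.2.1 j).1 = (Φ y j').1))
    (c : Fin m) (rc : ℕ) (hroot : (([] : List (Fin k)), (c, rc)) ∈ T) (j₀ : Fin k)
    (b : List (Fin k)) (r : ℕ) (hb : (b, (c, r)) ∈ T) (hbne : b ≠ []) :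
    ∃ L : ℕ, L ≤ b.length ∧ (∃ (w : ℕ → Fin m) (u o : ℕ → Fin k) (a : ℕ) (j : Fin k),
        w 0 = c ∧ a ≤ L ∧ (∀ a' b', a' ≤ L → b' ≤ L → w a' = w b' → a' = b') ∧
        (∀ d, d < L → (Φ (w (d + 1)) (u (d + 1))).1 = (Φ (w d) (o d)).1) ∧
        (L = 0 ∨ o L ≠ u L) ∧ (a < L ∨ j ≠ o L) ∧ (Φ (w L) (o L)).1 = (Φ (w a) j).1) := by
  obtain ⟨w, u, o, hw0, hwlen, hsteps, hin, hout, _⟩ :=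
    sissR_upWalk T Φ hfun hpar hsyn c rc hroot j₀ b c r hb
  have hlen : 1 ≤ b.length := by
    cases b with
    | nil => exact absurd rfl hbne
    | cons _ _ => simp
  obtain ⟨L, hL, hbad⟩ := sissR_walk_closed Φ b.length hlen w u o hsteps
    (fun i h1 h2 hcon => by
      have ha := hin i h1 (by omega)
      have hb' := hout i (by omega)
      rw [hcon] at ha; rw [ha] at hb'; exact absurd hb' (by simp))
    (fun d hd hww hcon => by
      have ha := hin (d + 1) (by omega) (by omega)
      have hb' := hout d hd
      rw [hww, hcon] at ha; rw [ha] at hb'; exact absurd hb' (by simp))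
    (by rw [hwlen, hw0])
  rw [hw0] at hbad
  exact ⟨L, by omega, hbad⟩

/-- **A non-injective witness tree yields a bad walk.** Let the tree code `T` be functional,
parent-closed, of depth `≤ D`, syntactically valid in `Φ`, with root clause `c`. If two distinct nodes
of `T` carry the same clause, then a bad walk of some length `L ≤ 2D` starts at `c`. -/
theorem sissR_injOrBad (T : Finset (List (Fin k) × (Fin m × ℕ))) (Φ : (Fin m → Fin k → Fin n × Bool))
    (hfun : ∀ (a : List (Fin k)) (lab lab' : Fin m × ℕ), (a, lab) ∈ T → (a, lab') ∈ T → lab = lab')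
    (hpar : ∀ (j : Fin k) (a : List (Fin k)) (lab : Fin m × ℕ), (j :: a, lab) ∈ T →
      ∃ lab' : Fin m × ℕ, (a, lab') ∈ T)
    (hsyn : ∀ e ∈ T, ∀ j : Fin k,
      (((Φ e.2.1 j).2 = true ↔ ∃ lab : Fin m × ℕ, (j :: e.1, lab) ∈ T) ∧
      ∀ (y : Fin m) (s : ℕ), (j :: e.1, (y, s)) ∈ T → ∃ j' : Fin k,
        (∀ lab : Fin m × ℕ, (j' :: j :: e.1, lab) ∉ T) ∧
        (∀ j'' : Fin k, j'' < j' → ∃ lab : Fin m × ℕ, (j'' :: j :: e.1, lab) ∈ T) ∧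
        (Φ e.2.1 j).1 = (Φ y j').1))
    (c : Fin m) (rc : ℕ) (hroot : (([] : List (Fin k)), (c, rc)) ∈ T) (j₀ : Fin k)
    (D : ℕ) (hlen : ∀ e ∈ T, e.1.length ≤ D)
    (hninj : ¬ ∀ e ∈ T, ∀ e' ∈ T, e.2.1 = e'.2.1 → e.1 = e'.1) :
    ∃ L : ℕ, L ≤ 2 * D ∧ (∃ (w : ℕ → Fin m) (u o : ℕ → Fin k) (a : ℕ) (j : Fin k),
        w 0 = c ∧ a ≤ L ∧ (∀ a' b', a' ≤ L → b' ≤ L → w a' = w b' → a' = b') ∧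
        (∀ d, d < L → (Φ (w (d + 1)) (u (d + 1))).1 = (Φ (w d) (o d)).1) ∧
        (L = 0 ∨ o L ≠ u L) ∧ (a < L ∨ j ≠ o L) ∧ (Φ (w L) (o L)).1 = (Φ (w a) j).1) := by
  -- the claim, by strong induction on the sum of the depths of the two nodes
  have main : ∀ N : ℕ, ∀ (b₁ b₂ : List (Fin k)) (x₁ x₂ : Fin m) (r₁ r₂ : ℕ),
      (b₁, (x₁, r₁)) ∈ T → (b₂, (x₂, r₂)) ∈ T → x₁ = x₂ → b₁ ≠ b₂ → b₁.length + b₂.length = N →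
      ∃ L : ℕ, L ≤ b₁.length + b₂.length ∧ (∃ (w : ℕ → Fin m) (u o : ℕ → Fin k) (a : ℕ) (j : Fin k),
        w 0 = c ∧ a ≤ L ∧ (∀ a' b', a' ≤ L → b' ≤ L → w a' = w b' → a' = b') ∧
        (∀ d, d < L → (Φ (w (d + 1)) (u (d + 1))).1 = (Φ (w d) (o d)).1) ∧
        (L = 0 ∨ o L ≠ u L) ∧ (a < L ∨ j ≠ o L) ∧ (Φ (w L) (o L)).1 = (Φ (w a) j).1) := by
    intro N
    induction N using Nat.strong_induction_on with
    | _ N ih =>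
      intro b₁ b₂ x₁ x₂ r₁ r₂ hb₁ hb₂ hxx hbb hN
      subst hxx
      cases b₁ with
      | nil =>
        cases b₂ with
        | nil => exact absurd rfl hbb
        | cons j₂ p₂ =>
          -- the root clause repeats below the root
          have hxc : x₁ = c := (Prod.mk.inj (hfun [] (x₁, r₁) (c, rc) hb₁ hroot)).1
          subst hxc
          obtain ⟨L, hL, hbad⟩ := sissR_badWalk_of_rootRepeat T Φ hfun hpar hsyn x₁ rc hroot j₀
            (j₂ :: p₂) r₂ hb₂ (List.cons_ne_nil _ _)
          exact ⟨L, by simp at hL ⊢; omega, hbad⟩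
      | cons j₁ p₁ =>
        cases b₂ with
        | nil =>
          have hxc : x₁ = c := (Prod.mk.inj (hfun [] (x₁, r₂) (c, rc) hb₂ hroot)).1
          subst hxc
          obtain ⟨L, hL, hbad⟩ := sissR_badWalk_of_rootRepeat T Φ hfun hpar hsyn x₁ rc hroot j₀
            (j₁ :: p₁) r₁ hb₁ (List.cons_ne_nil _ _)
          exact ⟨L, by simp at hL ⊢; omega, hbad⟩
        | cons j₂ p₂ =>
          -- both nodes have parents
          obtain ⟨⟨y₁, s₁⟩, hp₁⟩ := hpar j₁ p₁ (x₁, r₁) hb₁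
          obtain ⟨⟨y₂, s₂⟩, hp₂⟩ := hpar j₂ p₂ (x₁, r₂) hb₂
          obtain ⟨hsgn₁, jn₁, hjn₁, heq₁⟩ := sissR_edge_facts T Φ hsyn p₁ y₁ s₁ hp₁ j₁ x₁ r₁ hb₁
          obtain ⟨hsgn₂, jn₂, hjn₂, heq₂⟩ := sissR_edge_facts T Φ hsyn p₂ y₂ s₂ hp₂ j₂ x₁ r₂ hb₂
          have hjn : jn₁ = jn₂ := sissR_leastNeg_unique Φ x₁ jn₁ jn₂ hjn₁ hjn₂
          subst hjn
          have KEY : (Φ y₁ j₁).1 = (Φ y₂ j₂).1 := by rw [heq₁, heq₂]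
          by_cases hp : p₁ = p₂
          · -- siblings: walk down to the common parent, close with the two slots
            subst hp
            have hyy : y₁ = y₂ := (Prod.mk.inj (hfun p₁ (y₁, s₁) (y₂, s₂) hp₁ hp₂)).1
            subst hyy
            have hjj : j₁ ≠ j₂ := fun h => hbb (by rw [h])
            obtain ⟨w, u, o, hw0, hwlen, hsteps, hin, hout, _⟩ :=
              sissR_upWalk T Φ hfun hpar hsyn c rc hroot j₀ p₁ y₁ s₁ hp₁
            obtain ⟨W, U, O, hW0, hWP, hOP, hWsteps, hWin, hWout⟩ :=
              sissR_walk_rev Φ p₁.length w u o hsteps hin hout j₁ (by rw [hw0]; exact hsgn₁)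
            obtain ⟨L, hL, hbad⟩ := sissR_walk_extract Φ p₁.length W U O hWsteps
              (fun i h1 h2 hcon => by
                have ha := hWin i h1 h2
                have hb' := hWout i h2
                rw [hcon] at ha; rw [ha] at hb'; exact absurd hb' (by simp))
              (fun d hd hww hcon => by
                have ha := hWin (d + 1) (by omega) (by omega)
                have hb' := hWout d hd.le
                rw [hww, hcon] at ha; rw [ha] at hb'; exact absurd hb' (by simp))
              p₁.length j₂ (Or.inr ⟨rfl, by rw [hOP]; exact hjj.symm⟩)
              (by rw [hOP, hWP, hw0]; exact KEY)
            rw [hW0, hwlen] at hbad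
            exact ⟨L, by simp; omega, hbad⟩
          · by_cases hy : y₁ = y₂
            · -- the parents carry the same clause: induction
              obtain ⟨L, hL, hbad⟩ := ih (p₁.length + p₂.length) (by rw [← hN]; simp; omega)
                p₁ p₂ y₁ y₂ s₁ s₂ hp₁ hp₂ hy hp rfl
              exact ⟨L, by simp; omega, hbad⟩
            · -- down to the first parent, across to the second, up to the root
              obtain ⟨w₁, u₁, o₁, hw₁0, hw₁len, hsteps₁, hin₁, hout₁, _⟩ :=
                sissR_upWalk T Φ hfun hpar hsyn c rc hroot j₀ p₁ y₁ s₁ hp₁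
              obtain ⟨w₂, u₂, o₂, hw₂0, hw₂len, hsteps₂, hin₂, hout₂, _⟩ :=
                sissR_upWalk T Φ hfun hpar hsyn c rc hroot j₀ p₂ y₂ s₂ hp₂
              obtain ⟨W₁, U₁, O₁, hW₁0, hW₁P, hO₁P, hW₁steps, hW₁in, hW₁out⟩ :=
                sissR_walk_rev Φ p₁.length w₁ u₁ o₁ hsteps₁ hin₁ hout₁ j₁ (by rw [hw₁0]; exact hsgn₁)
              obtain ⟨W, U, O, hW0, hWM, hWsteps, hWio, hWsep⟩ :=
                sissR_walk_concat Φ p₁.length W₁ U₁ O₁ hW₁steps hW₁in hW₁out p₂.length w₂ u₂ o₂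
                  hsteps₂ hin₂ hout₂ j₂ (by rw [hw₂0]; exact hsgn₂)
                  (by rw [hw₂0, hW₁P, hw₁0, hO₁P]; exact KEY.symm)
                  (by rw [hW₁P, hw₁0, hw₂0]; exact hy)
              obtain ⟨L, hL, hbad⟩ := sissR_walk_closed Φ (p₁.length + 1 + p₂.length) (by omega)
                W U O hWsteps (fun i h1 h2 => hWio i h1 (by omega)) hWsep
                (by rw [hWM, hw₂len, hW0, hW₁0, hw₁len])
              rw [hW0, hW₁0, hw₁len] at hbad
              exact ⟨L, by simp; omega, hbad⟩
  -- two distinct nodes with the same clause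
  simp only [not_forall, exists_prop] at hninj
  obtain ⟨e, he, e', he', hxx, hne⟩ := hninj
  obtain ⟨L, hL, hbad⟩ := main _ e.1 e'.1 e.2.1 e'.2.1 e.2.2 e'.2.2 (by simpa using he)
    (by simpa using he') hxx hne rfl
  exact ⟨L, by have h1 := hlen e he; have h2 := hlen e' he'; omega, hbad⟩

end InjOrBad

end Summit.PneNP.PneNP.Theorems
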